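import Literature.Analysis.FunctionSpaces.HolderManifoldModelOperator
import Literature.Geometry.Riemannian.SchrodingerClosedManifold
import Literature.Geometry.Riemannian.RiemannianDistance
import HarnessLib

/-!
# Smooth solvability of `Δ_g u − u = f` and of `L₀ = Δ_g − 1` on `C^{k+2,r}_𝔄` (Hölder spaces, part 24)

Topic `Literature/Analysis/FunctionSpaces`. On a closed Riemannian manifold modelled on `ℝ^m`,
`m ≥ 1`, the model operator `L₀ = Δ_g − 1` (part 16) is solvable for smooth data: for smooth `f`
there is a smooth `u` with `Δ_g u − u = f`. This is the tree's `L²`-coercive Schrödinger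
solvability `exists_smooth_solution_schrodinger_of_coercive` (`SchrodingerClosedManifold.lean`;
Gilbarg–Trudinger 2001, Thm. 8.3 with Cor. 8.11) for `−Δ_g + 1`, whose form
`∫ (|∇w|²_g + w²) dV_g ≥ ∫ w² dV_g` is coercive with constant `1`, read through the bridge
`ofRiemannian (g.toContMDiffRiemannianMetric hg) = g` between the tree's pseudo-Riemannian
metrics and Mathlib's Riemannian metrics.

* `ofRiemannian_toContMDiffRiemannianMetric_eq'` — the bridge (by `ext; rfl`);
* `exists_smooth_solution_dalembertian_sub_self` — `∃ u ∈ C^∞, Δ_g u − u = f`;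
* `exists_modelOperator_eq_of_smooth` — hypothesis (2) ("smooth solvability") of
  `HolderManifoldFunction.surjective_of_estimate_of_smooth` (part 22) for
  `modelOperatorCLM 𝔄 g hr : C^{k+2,r}_𝔄 →L C^{k,r}_𝔄`.

Brick of census item (2c) of `Literature.Geometry.Riemannian.gurskyViaclovsky_pathOpen_weighted_four`.
Everything is proved; no named facts.

## References

* D. Gilbarg, N. S. Trudinger, *Elliptic Partial Differential Equations of Second Order* (2001),
  Thm. 8.3, Cor. 8.11, §6.3. [GilbargTrudinger2001]
-/

noncomputable section

open Set Filter Function MeasureTheory Bundle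
open scoped NNReal Topology Manifold ContDiff

namespace Literature.Analysis.FunctionSpaces

open Literature.Geometry.Lorentzian Literature.Geometry.Riemannian PseudoRiemannianMetric

section Solvability

variable {m : ℕ} {M : Type*} [TopologicalSpace M] [T2Space M] [CompactSpace M]
  [ChartedSpace (EuclideanSpace ℝ (Fin m)) M] [IsManifold (𝓡 m) ∞ M]
  (g : PseudoRiemannianMetric (𝓡 m) ∞ (EuclideanSpace ℝ (Fin m)) (TangentSpace (𝓡 m) : M → Type _))

omit [T2Space M] [CompactSpace M] in
/-- The bridge: the tree's pseudo-Riemannian metric of the Mathlib Riemannian metric of a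
Riemannian `g` is `g`. [folklore] -/
theorem ofRiemannian_toContMDiffRiemannianMetric_eq' (hg : g.IsRiemannian) :
    ofRiemannian (g.toContMDiffRiemannianMetric hg) = g := by
  ext
  rfl

omit [T2Space M] [CompactSpace M] in
/-- `Δ` depends only on the metric (the Levi-Civita instance is a proposition). [folklore] -/
theorem dalembertian_congr_metric
    {g₁ g₂ : PseudoRiemannianMetric (𝓡 m) ∞ (EuclideanSpace ℝ (Fin m)) (TangentSpace (𝓡 m) : M → Type _)}
    [g₁.HasLeviCivita] [g₂.HasLeviCivita] (h : g₁ = g₂) (u : M → ℝ) (x : M) :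
    g₁.dalembertian u x = g₂.dalembertian u x := by
  subst h
  rfl

/-- **Smooth solvability of `Δ_g u − u = f` on a closed Riemannian manifold** (`m ≥ 1`): for
smooth `f` there is a smooth `u` with `Δ_g u − u = f` — the coercive Schrödinger equation
`−Δ_g u + u = −f`. [cite: GilbargTrudinger2001, Thm. 8.3 and Cor. 8.11] -/
theorem exists_smooth_solution_dalembertian_sub_self [g.HasLeviCivita] (hm : 0 < m)
    (hg : g.IsRiemannian) {f : M → ℝ} (hf : ContMDiff (𝓡 m) 𝓘(ℝ, ℝ) ∞ f) :
    ∃ u : M → ℝ, ContMDiff (𝓡 m) 𝓘(ℝ, ℝ) ∞ u ∧ ∀ x, g.dalembertian u x - u x = f x := by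
  borelize M
  set h := g.toContMDiffRiemannianMetric hg with hh
  have hb : ofRiemannian h = g := ofRiemannian_toContMDiffRiemannianMetric_eq' g hg
  haveI : (ofRiemannian h).HasLeviCivita := by rw [hb]; infer_instance
  haveI : IsFiniteMeasure (riemannianMeasure h) := isFiniteMeasure_riemannianMeasure h
  have hcs : ∀ F : M → ℝ, HasCompactSupport F := fun F =>
    IsCompact.of_isClosed_subset isCompact_univ (isClosed_tsupport F) (subset_univ _)
  -- coercivity of `−Δ_g + 1` with constant `1`
  have hcoer : ∀ u : M → ℝ, ContMDiff (𝓡 m) 𝓘(ℝ, ℝ) 1 u →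
      (1 : ℝ) * ∫ x, u x ^ 2 ∂riemannianMeasure h ≤
        ∫ x, ((ofRiemannian h).gradSq u x + (fun _ => (1 : ℝ)) x * u x ^ 2)
          ∂riemannianMeasure h := by
    intro u hu
    rw [one_mul, hb]
    have hG0 : ∀ x, 0 ≤ g.gradSq u x := fun x => by
      rw [PseudoRiemannianMetric.gradSq, PseudoRiemannianMetric.innerDual_eq_val_sharp_sharp]
      by_cases h0 : g.sharp x (mvfderiv (𝓡 m) u x : TangentSpace (𝓡 m) x →ₗ[ℝ] ℝ) = 0
      · rw [h0]; simp
      · exact (hg x _ h0).le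
    have hGc : Continuous (g.gradSq u) := continuous_innerDual_mvfderiv g hu hu
    have hu2 : Integrable (fun x => u x ^ 2) (riemannianMeasure h) :=
      (hu.continuous.pow 2).integrable_of_hasCompactSupport (hcs _)
    have hsum : Integrable (fun x => g.gradSq u x + (fun _ => (1 : ℝ)) x * u x ^ 2)
        (riemannianMeasure h) := by
      refine (hGc.add ?_).integrable_of_hasCompactSupport (hcs _)
      exact continuous_const.mul (hu.continuous.pow 2)
    refine integral_mono hu2 hsum fun x => ?_
    dsimp only
    nlinarith [hG0 x]
  obtain ⟨u, hu, hsol⟩ := exists_smooth_solution_schrodinger_of_coercive h hm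
    (V := fun _ => (1 : ℝ)) (f := fun x => -f x) contMDiff_const hf.neg one_pos hcoer
  refine ⟨u, hu, fun x => ?_⟩
  have h1 := hsol x
  rw [dalembertian_congr_metric hb u x] at h1
  linarith

end Solvability

/-! ### Hypothesis (2) of part 22 for `L₀ = Δ_g − 1` -/

section Holder

variable {m : ℕ} {M : Type*} [TopologicalSpace M] [T2Space M] [CompactSpace M]
  [ChartedSpace (EuclideanSpace ℝ (Fin m)) M] [IsManifold (𝓡 m) ∞ M]
  {ι : Type*} [Fintype ι] (𝔄 : HolderChartData ι (EuclideanSpace ℝ (Fin m)) M)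
  (g : PseudoRiemannianMetric (𝓡 m) ∞ (EuclideanSpace ℝ (Fin m)) (TangentSpace (𝓡 m) : M → Type _))
  [g.HasLeviCivita] {k : ℕ} {r : ℝ≥0}

/-- **Smooth solvability of `L₀ = Δ_g − 1 : C^{k+2,r}_𝔄 → C^{k,r}_𝔄`**: every smooth member `f`
of `C^{k,r}_𝔄(M, ℝ)` is `L₀ u` for some `u ∈ C^{k+2,r}_𝔄(M, ℝ)` (the smooth solution of
`Δ_g u − u = f`, a member by `HolderManifoldFunction.ofContMDiff`).
[cite: GilbargTrudinger2001, Thm. 8.3 and Cor. 8.11] -/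
theorem exists_modelOperator_eq_of_smooth (hm : 0 < m) (hg : g.IsRiemannian) (hr : r ≤ 1)
    (f : HolderManifoldFunction 𝔄 ℝ k r) (hf : ContMDiff (𝓡 m) 𝓘(ℝ, ℝ) ∞ (f : M → ℝ)) :
    ∃ u : HolderManifoldFunction 𝔄 ℝ (k + 2) r, modelOperatorCLM 𝔄 g hr u = f := by
  obtain ⟨u, hu, hsol⟩ := exists_smooth_solution_dalembertian_sub_self g hm hg hf
  refine ⟨HolderManifoldFunction.ofContMDiff u hu hr, HolderManifoldFunction.ext fun x => ?_⟩
  rw [modelOperatorCLM_apply]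
  exact hsol x

end Holder

end Literature.Analysis.FunctionSpaces

end
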